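/-
Copyright: b2b-lace packet (LEAN typing seat 2, gen 15).  THE TWO-POINT LAW of the `W_d`-orbit sum: for
`x = c₁ e_a + c₂ e_b` (`a ≠ b`) and ANY function `f` on `ℤ^d`,
  `(2^d d!)⁻¹ Σ_{ρ ∈ W_d} f(x − ρx) = (4 d (d−1))⁻¹ Σ_{i ≠ k} Σ_{s,t = ±1} f(x − (s c₁ e_i + t c₂ e_k))`,
whence a computable majorant of `W_{n,j}(c₁ e_a + c₂ e_b)` from any termwise majorant of `I_{n,2j}`.
d-generic; no numeral; no `sorry`.
-/
import Literature.Probability.FitznerVanDerHofstad2017.SrwOrbitShellLaw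
import HarnessLib

/-!
# The two-point law of the orbit sum `Σ_{ρ ∈ W_d} f(x − ρx)` at `x = c₁ e_a + c₂ e_b`

CITATION HEADER (PLACEMENT v2). This module is part of a certified REPRODUCTION of:
R. Fitzner, R. van der Hofstad, *Mean-field behavior for nearest-neighbor percolation in d > 10*,
Electron. J. Probab. 22 (2017), no. 43 [FvdH17], and *Generalized approach to the non-backtracking lace
expansion*, Probab. Theory Related Fields 169 (2017) 1041–1119 [NoBLE17-I] (arXiv:1506.07977, 1506.07969).
Reproduces: the COUNTING behind the notebook cells `L[n,x]`, `K[n,l,x]`, `T[n,l,x]`, `U[n,l,x]` of `SRW.nb` §2 at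
the TWO-AXIS nodes `x = e₁ + 2e₂` (and `e₁ + e₂`, …) — the placement formula (5.16)
`W_{n,j}(x) = |W_d|⁻¹ Σ_{ρ ∈ W_d} I_{n,2j}(x − ρx)` evaluated at `x = c₁ e_a + c₂ e_b` as a finite sum over the
`4 d (d−1)` images `ρx = s c₁ e_i + t c₂ e_k` (`i ≠ k`, `s, t = ±1`), each hit by exactly `2^{d-2} (d−2)!` signed
permutations.  Origin: build `lace`, leaf (S2b)-IMPR L8 ("the f₃-read `T/U` cells"), typing seat 2 (lean2-g15);
companion of `SrwOrbitShellLaw` (the indicator-vector nodes); consumed by `MeanFieldD11Stage1TabsTU` (`d = 11`).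

## What is here (all `d`-generic, [folklore] counting)

* `spAct_single`, `spAct_add`, `spAct_pair` — a signed permutation maps `c₁ e_a + c₂ e_b` to
  `δ(π⁻¹a) c₁ e_{π⁻¹a} + δ(π⁻¹b) c₂ e_{π⁻¹b}`;
* `pairMap_transitive` — the fibres of `ρ ↦ ((π⁻¹a, π⁻¹b), δ(π⁻¹a), δ(π⁻¹b))` are permuted transitively by
  self-bijections of `W_d` (so the averaging principle `sum_comp_div_card_eq_of_transitive` applies);
* `sum_pairIdx` — a sum over the index type `{(i,k) : i ≠ k} × {±1}²` as an explicit double sum;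
  `card_pairIdx_real` — its cardinality `4 d (d−1)`;
* `orbitSum_pair_eq` — the two-point law above;
* `srwW_pair_le_of_termBound` — for `d ≥ 2n+1`:
  `W_{n,j}(c₁ e_a + c₂ e_b) ≤ (4 d (d−1))⁻¹ Σ_{i ≠ k} Σ_{s,t} B(i,k,s,t)` for any termwise majorant
  `I_{n,2j}(x − (s c₁ e_i + t c₂ e_k)) ≤ B(i,k,s,t)`.

## What is NOT here
No dimension, no table, no numeric value; nothing cited beyond the tree's (5.16) (`srwW_eq_orbit_sum`).

## References
* [NoBLE17-I] R. Fitzner, R. van der Hofstad, PTRF 169 (2017) 1041–1119; arXiv:1506.07969 — (5.16) p. 1092,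
  notebook `SRW.nb` §2 (arXiv:1506.07977 anc), cells `L[n_,x_]`, `K[n_,l_,x_]`.
-/

namespace Literature.Probability.FitznerVanDerHofstad2017

open Finset

variable {d : ℕ}

/-! ### Signed permutations on one- and two-axis vectors -/

/-- `ρ (c e_a) = δ(π⁻¹ a) c · e_{π⁻¹ a}` for `ρ = (π, δ)`. [folklore] -/
theorem spAct_single (ρ : SgnPermPair d) (a : Fin d) (c : ℤ) :
    spAct ρ (Pi.single a c) = Pi.single (ρ.1.symm a) ((ρ.2 (ρ.1.symm a) : ℤ) * c) := by
  funext i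
  rw [spAct_apply]
  by_cases h : i = ρ.1.symm a
  · subst h
    rw [Pi.single_eq_same, Equiv.apply_symm_apply, Pi.single_eq_same]
  · have h' : ρ.1 i ≠ a := fun e => h (by rw [← e, Equiv.symm_apply_apply])
    rw [Pi.single_eq_of_ne h', Pi.single_eq_of_ne h, mul_zero]

/-- `spAct ρ` is additive. [folklore] -/
theorem spAct_add (ρ : SgnPermPair d) (x y : Fin d → ℤ) : spAct ρ (x + y) = spAct ρ x + spAct ρ y := by
  funext i
  simp only [spAct_apply, Pi.add_apply, mul_add]

/-- The index type of the two-point law: ordered pairs of distinct axes and two signs. [folklore] -/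
abbrev PairIdx (d : ℕ) := {p : Fin d × Fin d // p.1 ≠ p.2} × ℤˣ × ℤˣ

/-- The point `s c₁ e_i + t c₂ e_k` indexed by `q = ((i,k), s, t)`. [folklore] -/
def pairPt (c₁ c₂ : ℤ) (q : PairIdx d) : Fin d → ℤ :=
  Pi.single q.1.1.1 ((q.2.1 : ℤ) * c₁) + Pi.single q.1.1.2 ((q.2.2 : ℤ) * c₂)

/-- The orbit map `ρ = (π, δ) ↦ ((π⁻¹ a, π⁻¹ b), δ(π⁻¹ a), δ(π⁻¹ b))`. [folklore] -/
def pairMap {a b : Fin d} (hab : a ≠ b) (ρ : SgnPermPair d) : PairIdx d :=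
  (⟨(ρ.1.symm a, ρ.1.symm b), fun h => hab (ρ.1.symm.injective h)⟩, ρ.2 (ρ.1.symm a), ρ.2 (ρ.1.symm b))

/-- `ρ (c₁ e_a + c₂ e_b)` is the two-axis point indexed by `pairMap ρ`. [folklore] -/
theorem spAct_pair {a b : Fin d} (hab : a ≠ b) (c₁ c₂ : ℤ) (ρ : SgnPermPair d) :
    spAct ρ (Pi.single a c₁ + Pi.single b c₂) = pairPt c₁ c₂ (pairMap hab ρ) := by
  rw [spAct_add, spAct_single, spAct_single]
  rfl

/-- Two ordered pairs of distinct axes are exchanged by a permutation. [folklore] -/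
theorem exists_perm_pair {i j i' j' : Fin d} (hij : i ≠ j) (hij' : i' ≠ j') :
    ∃ ν : Equiv.Perm (Fin d), ν i' = i ∧ ν j' = j := by
  have hy : Equiv.swap i i' j' ≠ i := by
    intro h
    have h2 : Equiv.swap i i' j' = Equiv.swap i i' i' := by rw [h, Equiv.swap_apply_right]
    exact hij' ((Equiv.injective _ h2).symm)
  refine ⟨Equiv.swap (Equiv.swap i i' j') j * Equiv.swap i i', ?_, ?_⟩
  · rw [Equiv.Perm.mul_apply, Equiv.swap_apply_right]
    exact Equiv.swap_apply_of_ne_of_ne hy.symm hij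
  · rw [Equiv.Perm.mul_apply, Equiv.swap_apply_left]

/-- The fibres of the orbit map are permuted transitively by self-bijections of `W_d`
(`(π, δ) ↦ (π ν, (δ ∘ ν) · ε)`). [folklore] -/
theorem pairMap_transitive {a b : Fin d} (hab : a ≠ b) (q q' : PairIdx d) :
    ∃ e : SgnPermPair d ≃ SgnPermPair d, ∀ ρ, pairMap hab (e ρ) = q' ↔ pairMap hab ρ = q := by
  obtain ⟨⟨⟨i, j⟩, hij⟩, s, t⟩ := q
  obtain ⟨⟨⟨i', j'⟩, hij'⟩, s', t'⟩ := q'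
  simp only [ne_eq] at hij hij'
  obtain ⟨ν, hνi, hνj⟩ := exists_perm_pair hij hij'
  have hji' : ¬ j' = i' := fun h => hij' h.symm
  let ε : Fin d → ℤˣ := fun μ => if μ = i' then s⁻¹ * s' else if μ = j' then t⁻¹ * t' else 1
  let eδ : (Fin d → ℤˣ) ≃ (Fin d → ℤˣ) :=
    { toFun := fun δ μ => δ (ν μ) * ε μ
      invFun := fun δ μ => δ (ν.symm μ) * (ε (ν.symm μ))⁻¹
      left_inv := fun δ => funext fun μ => by simp only [Equiv.apply_symm_apply, mul_inv_cancel_right]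
      right_inv := fun δ => funext fun μ => by simp only [Equiv.symm_apply_apply, inv_mul_cancel_right] }
  have hε1 : ε i' = s⁻¹ * s' := by simp [ε]
  have hε2 : ε j' = t⁻¹ * t' := by simp [ε, hji']
  have hn1 : ν.symm i = i' := by rw [Equiv.symm_apply_eq, hνi]
  have hn2 : ν.symm j = j' := by rw [Equiv.symm_apply_eq, hνj]
  have key : ∀ u v v' : ℤˣ, u * (v⁻¹ * v') = v' ↔ u = v := by decide
  refine ⟨Equiv.prodCongr (Equiv.mulRight ν) eδ, fun ρ => ?_⟩
  obtain ⟨π, δ⟩ := ρ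
  simp only [pairMap, eδ, Equiv.prodCongr_apply, Prod.map, Equiv.coe_mulRight, Equiv.coe_fn_mk, Prod.mk.injEq,
    Subtype.mk.injEq, Equiv.Perm.mul_def, Equiv.symm_trans_apply, Equiv.apply_symm_apply]
  generalize π.symm a = y₁
  generalize π.symm b = y₂
  constructor
  · rintro ⟨⟨h1, h2⟩, h3, h4⟩
    rw [Equiv.symm_apply_eq, hνi] at h1
    rw [Equiv.symm_apply_eq, hνj] at h2
    rw [h1, hn1, hε1, key] at h3
    rw [h2, hn2, hε2, key] at h4
    rw [h1, h2]
    exact ⟨⟨rfl, rfl⟩, h3, h4⟩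
  · rintro ⟨⟨h1, h2⟩, h3, h4⟩
    rw [h1, hn1, hε1, key, h2, hn2, hε2, key]
    rw [h1] at h3
    rw [h2] at h4
    exact ⟨⟨rfl, rfl⟩, h3, h4⟩

/-! ### Sums over the index type -/

/-- A sum over `{(i,k) : i ≠ k} × {±1}²` as an explicit double sum over all `(i,k)` (zero on the diagonal).
[folklore] -/
theorem sum_pairIdx (F : Fin d → Fin d → ℤˣ → ℤˣ → ℝ) :
    ∑ q : PairIdx d, F q.1.1.1 q.1.1.2 q.2.1 q.2.2 =
      ∑ i : Fin d, ∑ k : Fin d, if i = k then 0 else ∑ s : ℤˣ, ∑ t : ℤˣ, F i k s t := by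
  rw [Fintype.sum_prod_type]
  simp_rw [Fintype.sum_prod_type (f := fun x : ℤˣ × ℤˣ => F _ _ x.1 x.2)]
  have h : ∀ pr : Fin d × Fin d, pr ∈ univ.filter (fun pr : Fin d × Fin d => pr.1 ≠ pr.2) ↔ pr.1 ≠ pr.2 := by
    simp
  rw [← Finset.sum_subtype (univ.filter fun pr : Fin d × Fin d => pr.1 ≠ pr.2) h
    (fun pr : Fin d × Fin d => ∑ s : ℤˣ, ∑ t : ℤˣ, F pr.1 pr.2 s t), sum_filter, Fintype.sum_prod_type]
  refine sum_congr rfl fun i _ => sum_congr rfl fun k _ => ?_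
  simp only [ne_eq, ite_not]

/-- `|{(i,k) : i ≠ k} × {±1}²| = 4 d (d−1)` (as a real). [folklore] -/
theorem card_pairIdx_real : (Fintype.card (PairIdx d) : ℝ) = 4 * d * (d - 1 : ℝ) := by
  have h1 : (Fintype.card (PairIdx d) : ℝ) = ∑ _q : PairIdx d, (1 : ℝ) := by simp
  have h0 := sum_pairIdx (d := d) (fun _ _ _ _ => (1 : ℝ))
  have hu : ∀ F : ℤˣ → ℝ, ∑ u : ℤˣ, F u = F 1 + F (-1) := fun F => by
    have huniv : (univ : Finset ℤˣ) = {1, -1} := by decide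
    rw [huniv, sum_pair (by decide)]
  rw [h1, h0]
  simp only [hu]
  have h2 : ∀ i : Fin d, (∑ k : Fin d, if i = k then (0 : ℝ) else 1 + 1 + (1 + 1)) = 4 * d - 4 := by
    intro i
    have e1 : (∑ k : Fin d, ((if i = k then (0 : ℝ) else 1 + 1 + (1 + 1)) + (if i = k then (4 : ℝ) else 0))) =
        ∑ _k : Fin d, (4 : ℝ) := sum_congr rfl fun k _ => by split_ifs <;> norm_num
    rw [sum_add_distrib, sum_ite_eq, if_pos (mem_univ _), sum_const, card_univ, Fintype.card_fin,
      nsmul_eq_mul] at e1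
    linarith
  simp only [h2, sum_const, card_univ, Fintype.card_fin, nsmul_eq_mul]
  ring

/-! ### The two-point law -/

/-- **The two-point law of the orbit sum.**  For `a ≠ b` and any `f`:
`(2^d d!)⁻¹ Σ_{ρ ∈ W_d} f(x − ρ x) = (4d(d−1))⁻¹ Σ_{i ≠ k} Σ_{s,t = ±1} f(x − (s c₁ e_i + t c₂ e_k))`,
`x = c₁ e_a + c₂ e_b`. [cite: FitznerVanDerHofstad2016NoBLE, (5.16) p. 1092] -/
theorem orbitSum_pair_eq {a b : Fin d} (hab : a ≠ b) (c₁ c₂ : ℤ) (f : (Fin d → ℤ) → ℝ) :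
    (∑ ρ : SgnPermPair d, f (Pi.single a c₁ + Pi.single b c₂ - spAct ρ (Pi.single a c₁ + Pi.single b c₂))) /
        (2 ^ d * (d.factorial : ℝ)) =
      (∑ i : Fin d, ∑ k : Fin d, if i = k then 0 else ∑ s : ℤˣ, ∑ t : ℤˣ,
          f (Pi.single a c₁ + Pi.single b c₂ - (Pi.single i ((s : ℤ) * c₁) + Pi.single k ((t : ℤ) * c₂)))) /
        (4 * d * (d - 1 : ℝ)) := by
  haveI : Nonempty (PairIdx d) := ⟨(⟨(a, b), hab⟩, 1, 1)⟩
  simp_rw [spAct_pair hab]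
  have key := sum_comp_div_card_eq_of_transitive (pairMap hab) (pairMap_transitive hab)
      (fun q => f (Pi.single a c₁ + Pi.single b c₂ - pairPt c₁ c₂ q))
  rw [← card_sgnPermPair_real, key, card_pairIdx_real]
  congr 1
  exact sum_pairIdx fun i k s t => f (Pi.single a c₁ + Pi.single b c₂ - (Pi.single i ((s : ℤ) * c₁) + Pi.single k ((t : ℤ) * c₂)))

/-- **Two-point majorant of `W_{n,j}(c₁ e_a + c₂ e_b)`** (`d ≥ 2n+1`, `a ≠ b`): any termwise majorant
`I_{n,2j}(x − (s c₁ e_i + t c₂ e_k)) ≤ B(i,k,s,t)` (`i ≠ k`) gives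
`W_{n,j}(x) ≤ (4d(d−1))⁻¹ Σ_{i ≠ k} Σ_{s,t} B(i,k,s,t)`. [cite: FitznerVanDerHofstad2016NoBLE, (5.16) p. 1092] -/
theorem srwW_pair_le_of_termBound {n : ℕ} (hd : 2 * n + 1 ≤ d) (j : ℕ) {a b : Fin d} (hab : a ≠ b)
    (c₁ c₂ : ℤ) (B : Fin d → Fin d → ℤˣ → ℤˣ → ℝ)
    (hB : ∀ i k : Fin d, i ≠ k → ∀ s t : ℤˣ,
      srwI d n (2 * j) (Pi.single a c₁ + Pi.single b c₂ -
        (Pi.single i ((s : ℤ) * c₁) + Pi.single k ((t : ℤ) * c₂))) ≤ B i k s t) :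
    srwW d n j (Pi.single a c₁ + Pi.single b c₂) ≤
      (∑ i : Fin d, ∑ k : Fin d, if i = k then 0 else ∑ s : ℤˣ, ∑ t : ℤˣ, B i k s t) /
        (4 * d * (d - 1 : ℝ)) := by
  have hd2 : (2 : ℝ) ≤ d := by
    have : a.val < d := a.isLt
    have : b.val < d := b.isLt
    have hne : a.val ≠ b.val := fun h => hab (Fin.ext h)
    have : 2 ≤ d := by omega
    exact_mod_cast this
  rw [srwW_eq_orbit_sum hd, orbitSum_pair_eq hab c₁ c₂]
  refine div_le_div_of_nonneg_right (sum_le_sum fun i _ => sum_le_sum fun k _ => ?_) (by nlinarith)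
  split_ifs with hik
  · exact le_rfl
  · exact sum_le_sum fun s _ => sum_le_sum fun t _ => hB i k hik s t

end Literature.Probability.FitznerVanDerHofstad2017
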